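import Mathlib
import Literature.MathematicalPhysics.KineticTheory.FouriersLaw
import Literature.MathematicalPhysics.KineticTheory.LangevinChainKernel
import Literature.MathematicalPhysics.KineticTheory.LangevinChainGibbs
import Literature.MathematicalPhysics.KineticTheory.InfiniteChainDynamics

/-!
# Sketch — crux-ideate stmt-AtomisticToContinuum-14013 (`LatticeLandauDamping.AbelThermodynamicLimit`,
definitionally the same Prop as `EmbeddedDrudeMourre.AbelThermodynamicLimit`, stmt-12596), round 1, ideator 2 (planner-cruxidea-stmt-AtomisticToContinuum-14013-2-0, 2026-08-16). Published as Cruxes/AbelThermodynamicLimit/SketchIdeator2.lean (the directory is shared with stmt-12596, whose ideator-2 seat never published a sketch).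

Two crux idea cards, first lemmas:

* Card `series-law-at-every-laplace-frequency` (namespace `SeriesLawAtEveryLaplaceFrequency`):
  `resolventResistance` — R_N(ν) := (N−1)² T² / F_N(ν), the Laplace-resolved bath-to-bath resistance
  (R_N(0⁺) = (N−1)/D_N by the Kundu–Dhar–Narayan identity F_N(0⁺) = (N−1)T²D_N);
  `QuasiSuperadditiveResistanceForm` — the SIGN LAW (QSR): ν-uniform quasi-superadditivity of R_N(ν) under
  concatenation (its DC shadow is the live crux `JunctionLocality.SuperadditiveResistance`, stmt-11748);
  `QuasiSuperadditiveResistanceFormDBE` — the de Bruijn–Erdős-robust form (sub-linear summable allowance);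
  `series_abel_lower` — PROVED: QSR + per-length identification at each ν > 0 + the closed-chain Abel
  hypothesis ⇒ R_N(0⁺) ≤ N·ρ₀ + C for every N (the resistance-side twin of `fekete_abel_upper`);
  `conductance_lower_of_resistance`, `two_sign_laws_tendsto` — PROVED: the lower half liminf D_N ≥ κ_A, and
  with the conductance-side sign law (card fekete-at-every-laplace-frequency) D_N → κ_A.
* Card `abel-late-antiecho` (namespace `AbelLateAntiecho`):
  `antiecho_lower` — PROVED: F(0⁺) − F(ν) ≥ −∫(1−e^{−νt}) c⁻(t) dt (one-sided Abel comparison);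
  `NoExtensiveAntiecho` — the one-sided (negative-part) late-window statement;
  `antiecho_abel_lower` — the abstract lower-half interchange lemma.
-/

noncomputable section

open MeasureTheory Filter Topology Set
open scoped NNReal BigOperators

namespace Summit.AtomisticToContinuum.FouriersLaw.Cruxes.AbelThermodynamicLimit.SeriesLawAtEveryLaplaceFrequency

open Literature.MathematicalPhysics.KineticTheory.HeatConduction

/-- Total bond current `J = Σ_b j_b` of the `N`-chain. -/
def totalCurrentObs (P : OscillatorChain) (N : ℕ) (x : PhaseSpace N) : ℝ :=
  ∑ i : Fin N, P.bondCurrent N i x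

/-- Equilibrium current autocorrelation of the OPEN chain (both baths at `T`):
`c_N(t) = ∫ J(x) · (P_t J)(x) dμ_{N,T}(x)` (as in route StaticAbelianSqueeze and card
fekete-at-every-laplace-frequency). -/
def currentAutocorr (P : OscillatorChain) (N : ℕ) (T : ℝ) (t : ℝ) : ℝ :=
  ∫ x, totalCurrentObs P N x *
      (∫ y, totalCurrentObs P N y ∂(P.transitionKernel N T T t.toNNReal x)) ∂(P.gibbsMeasure N T)

/-- The current resolvent form `F_N(ν) = ∫₀^∞ e^{-νt} c_N(t) dt`. -/
def currentResolventForm (P : OscillatorChain) (N : ℕ) (T : ℝ) (ν : ℝ) : ℝ :=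
  ∫ t in Ioi (0 : ℝ), Real.exp (-(ν * t)) * currentAutocorr P N T t

/-- **Laplace-resolved resistance** `R_N(ν) := (N−1)² T² / F_N(ν)` of the `N`-chain between its two
Langevin baths at temperature `T`. At `ν = 0⁺` and fixed `N`, `R_N(0⁺) = (N−1)²T²/((N−1)T²D_N) = (N−1)/D_N`
is the bath-to-bath thermal resistance `δT/J̃` of clause (ii) (KDN identity). -/
def resolventResistance (P : OscillatorChain) (N : ℕ) (T ν : ℝ) : ℝ :=
  ((N : ℝ) - 1) ^ 2 * T ^ 2 / currentResolventForm P N T ν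

/-- **(QSR) ν-uniform quasi-superadditivity of the Laplace-resolved resistance** (the sign law of card
`series-law-at-every-laplace-frequency`): for the pinned anharmonic chain and every `T > 0` there are
`C ≥ 0`, `ν₀ > 0` such that `R_{N+M}(ν) ≥ R_N(ν) + R_M(ν) − C` for all `N, M ≥ 2`, uniformly in
`ν ∈ (0, ν₀]` — cutting an `(N+M)`-chain into an `N`- and an `M`-chain (each re-terminated by Langevin
baths) never LOWERS the Laplace-resolved resistance by more than a junction constant. Its DC shadow
(`ν ↓ 0` at fixed `N, M`) is `JunctionLocality.SuperadditiveResistance` (stmt-11748). -/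
def QuasiSuperadditiveResistanceForm : Prop :=
  ∀ ω₂ lam β γ : ℝ, 0 < ω₂ → 0 < lam → 0 < β → 0 < γ → ∀ T : ℝ, 0 < T →
    ∃ C ν₀ : ℝ, 0 ≤ C ∧ 0 < ν₀ ∧ ∀ ν ∈ Ioc (0 : ℝ) ν₀, ∀ N M : ℕ, 2 ≤ N → 2 ≤ M →
      resolventResistance (pinnedChain ω₂ lam β γ) N T ν +
          resolventResistance (pinnedChain ω₂ lam β γ) M T ν - C ≤
        resolventResistance (pinnedChain ω₂ lam β γ) (N + M) T ν

/-- **(QSR-dBE) the de Bruijn–Erdős-robust form**: the junction allowance may grow sub-linearly,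
`R_{N+M}(ν) ≥ R_N(ν) + R_M(ν) − f(N+M)` with `f` non-decreasing and `Σ f(n)/n² < ∞` (e.g. `f(n) = C n^θ`,
`θ < 1`), uniformly in `ν ∈ (0, ν₀]`. The dyadic iteration still gives `R_N(ν) ≤ N·ρ_ν + N·Σ_{j≥1} f(2^jN)/(2^jN)
= N·ρ_ν + o(N)` uniformly in `ν`, which is all the lower half needs; this form tolerates any power-law
finite-size approach of `D_N` to `κ` from below. -/
def QuasiSuperadditiveResistanceFormDBE : Prop :=
  ∀ ω₂ lam β γ : ℝ, 0 < ω₂ → 0 < lam → 0 < β → 0 < γ → ∀ T : ℝ, 0 < T →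
    ∃ (f : ℕ → ℝ) (ν₀ : ℝ), Monotone f ∧ (∀ n, 0 ≤ f n) ∧
      Summable (fun n : ℕ => f n / (n : ℝ) ^ 2) ∧ 0 < ν₀ ∧
      ∀ ν ∈ Ioc (0 : ℝ) ν₀, ∀ N M : ℕ, 2 ≤ N → 2 ≤ M →
        resolventResistance (pinnedChain ω₂ lam β γ) N T ν +
            resolventResistance (pinnedChain ω₂ lam β γ) M T ν - f (N + M) ≤
          resolventResistance (pinnedChain ω₂ lam β γ) (N + M) T ν

/-- **Series law at every Laplace frequency ⇒ resistances sit below resistivity × length.**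
Pure real analysis, verbatim the interchange lemma `fekete_abel_upper` of card
fekete-at-every-laplace-frequency applied to the RESISTANCE form: if `R N ν` is quasi-superadditive in
`N` uniformly in `ν ∈ (0, ν₀]` (QSR), if for each such `ν` the per-length limit `R N ν / N → ρ ν` holds
(fixed-ν identification: `ρ ν = T²/K_ν`, `K_ν` the closed chain's Abel function), if `ρ ν → ρ₀` as `ν ↓ 0`
(the Abel witness: `ρ₀ = 1/κ_A`), and if `R N` has the right limit `R0 N` at `ν = 0` (KDN: `R0 N = (N−1)/D_N`),
then `R0 N ≤ N·ρ₀ + C` for every `N ≥ 2` — no finite chain is more resistive than bulk resistivity ×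
length plus a junction constant. -/
theorem series_abel_lower (R : ℕ → ℝ → ℝ) (R0 : ℕ → ℝ) (ρ : ℝ → ℝ) (C ρ₀ ν₀ : ℝ) (hν₀ : 0 < ν₀)
    (hQSR : ∀ ν ∈ Ioc (0 : ℝ) ν₀, ∀ N M : ℕ, 2 ≤ N → 2 ≤ M → R N ν + R M ν - C ≤ R (N + M) ν)
    (hlim : ∀ ν ∈ Ioc (0 : ℝ) ν₀, Tendsto (fun N : ℕ => R N ν / N) atTop (𝓝 (ρ ν)))
    (hρ : Tendsto ρ (𝓝[>] 0) (𝓝 ρ₀))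
    (hDC : ∀ N : ℕ, 2 ≤ N → Tendsto (R N) (𝓝[>] 0) (𝓝 (R0 N))) :
    ∀ N : ℕ, 2 ≤ N → R0 N ≤ N * ρ₀ + C := by
  intro N hN
  have hNpos : 0 < N := by omega
  have hNposR : (0 : ℝ) < N := by exact_mod_cast hNpos
  have key : ∀ ν ∈ Ioc (0 : ℝ) ν₀, R N ν ≤ N * ρ ν + C := by
    intro ν hν
    have iter : ∀ k : ℕ, 1 ≤ k → (k : ℝ) * R N ν - ((k : ℝ) - 1) * C ≤ R (k * N) ν := by
      intro k hk
      induction k with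
      | zero => omega
      | succ k ih =>
        rcases Nat.eq_zero_or_pos k with rfl | hkpos
        · simp
        · have ih' := ih hkpos
          have hkN : 2 ≤ k * N := le_trans hN (Nat.le_mul_of_pos_left N hkpos)
          have hq := hQSR ν hν (k * N) N hkN hN
          have hcast : ((k + 1 : ℕ) : ℝ) = (k : ℝ) + 1 := by push_cast; ring
          have hidx : (k + 1) * N = k * N + N := by ring
          rw [hidx, hcast]
          linarith
    have hmul : Tendsto (fun k : ℕ => k * N) atTop atTop :=
      tendsto_atTop_atTop.2 fun b => ⟨b, fun k hk => le_trans hk (Nat.le_mul_of_pos_right k hNpos)⟩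
    have hsub : Tendsto (fun k : ℕ => R (k * N) ν / ((k * N : ℕ) : ℝ)) atTop (𝓝 (ρ ν)) :=
      (hlim ν hν).comp hmul
    have hRHS : Tendsto (fun k : ℕ => (R N ν - C) / N + C / N / (k : ℝ)) atTop
        (𝓝 ((R N ν - C) / N + 0)) :=
      tendsto_const_nhds.add (tendsto_const_div_atTop_nhds_zero_nat (C / N))
    have hlow : ∀ᶠ k : ℕ in atTop,
        (R N ν - C) / N + C / N / (k : ℝ) ≤ R (k * N) ν / ((k * N : ℕ) : ℝ) := by
      filter_upwards [eventually_ge_atTop 1] with k hk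
      have hkposR : (0 : ℝ) < k := by exact_mod_cast hk
      have h := iter k hk
      have e1 : (R N ν - C) / N + C / N / (k : ℝ) =
          ((k : ℝ) * R N ν - ((k : ℝ) - 1) * C) / ((k * N : ℕ) : ℝ) := by
        push_cast
        field_simp
        ring
      rw [e1]
      exact div_le_div_of_nonneg_right h (by positivity)
    have hle : (R N ν - C) / N + 0 ≤ ρ ν := le_of_tendsto_of_tendsto hRHS hsub hlow
    rw [add_zero, div_le_iff₀ hNposR] at hle
    linarith
  have hev : ∀ᶠ ν in 𝓝[>] (0 : ℝ), R N ν ≤ N * ρ ν + C := by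
    filter_upwards [Ioc_mem_nhdsGT hν₀] with ν hν using key ν hν
  have hlimG : Tendsto (fun ν => (N : ℝ) * ρ ν + C) (𝓝[>] (0 : ℝ)) (𝓝 (N * ρ₀ + C)) :=
    (hρ.const_mul (N : ℝ)).add_const C
  exact le_of_tendsto_of_tendsto (hDC N hN) hlimG hev

/-- **The lower half.** A resistance bound `(N−1)/D_N ≤ N/κ + C` with `κ > 0`, `C ≥ 0` and `D_N > 0` is the
conductance lower envelope `D_N ≥ κ(N−1)/(N + Cκ)`. -/
theorem conductance_lower_of_resistance (D : ℕ → ℝ) (κ C : ℝ) (hκ : 0 < κ) (hC : 0 ≤ C)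
    (hpos : ∀ N : ℕ, 2 ≤ N → 0 < D N)
    (hR : ∀ N : ℕ, 2 ≤ N → ((N : ℝ) - 1) / D N ≤ N * κ⁻¹ + C) :
    ∀ N : ℕ, 2 ≤ N → κ * (((N : ℝ) - 1) / ((N : ℝ) + C * κ)) ≤ D N := by
  intro N hN
  have hD := hpos N hN
  have hNR : (2 : ℝ) ≤ N := by exact_mod_cast hN
  have hden : 0 < (N : ℝ) + C * κ := by positivity
  have h := hR N hN
  rw [div_le_iff₀ hD] at h
  -- (N-1) ≤ (N/κ + C) D  ⇒ κ (N-1) ≤ (N + Cκ) D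
  have h2 : κ * ((N : ℝ) - 1) ≤ ((N : ℝ) + C * κ) * D N := by
    have := mul_le_mul_of_nonneg_left h hκ.le
    have e : κ * ((N : ℝ) * κ⁻¹ + C) = (N : ℝ) + C * κ := by field_simp
    calc κ * ((N : ℝ) - 1) ≤ κ * (((N : ℝ) * κ⁻¹ + C) * D N) := this
      _ = ((N : ℝ) + C * κ) * D N := by rw [← mul_assoc, e]
  rw [mul_div_assoc']
  rw [div_le_iff₀ hden]
  linarith [mul_comm ((N : ℝ) + C * κ) (D N)]

/-- The lower envelope tends to `κ`. -/
theorem tendsto_lower_envelope (κ C : ℝ) :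
    Tendsto (fun N : ℕ => κ * (((N : ℝ) - 1) / ((N : ℝ) + C * κ))) atTop (𝓝 κ) := by
  have h1 : Tendsto (fun N : ℕ => (N : ℝ) / ((N : ℝ) + C * κ)) atTop (𝓝 1) :=
    tendsto_natCast_div_add_atTop (C * κ)
  have h2 : Tendsto (fun N : ℕ => ((N : ℝ) + C * κ)⁻¹) atTop (𝓝 0) := by
    have : Tendsto (fun N : ℕ => (N : ℝ) + C * κ) atTop atTop :=
      tendsto_natCast_atTop_atTop.atTop_add tendsto_const_nhds
    exact this.inv_tendsto_atTop
  have h3 : Tendsto (fun N : ℕ => ((N : ℝ) - 1) / ((N : ℝ) + C * κ)) atTop (𝓝 (1 - 0)) := by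
    have := h1.sub h2
    refine this.congr' ?_
    filter_upwards [eventually_gt_atTop 0] with N hN
    have hNR : (0 : ℝ) < N := by exact_mod_cast hN
    field_simp
  simpa using h3.const_mul κ

/-- The upper envelope `(Nκ + C')/(N−1)` (from the conductance-side sign law) tends to `κ`. -/
theorem tendsto_upper_envelope (κ C' : ℝ) :
    Tendsto (fun N : ℕ => ((N : ℝ) * κ + C') / ((N : ℝ) - 1)) atTop (𝓝 κ) := by
  have h1 : Tendsto (fun N : ℕ => (N : ℝ) / ((N : ℝ) + (-1))) atTop (𝓝 1) :=
    tendsto_natCast_div_add_atTop (-1)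
  have h2 : Tendsto (fun N : ℕ => ((N : ℝ) + (-1))⁻¹) atTop (𝓝 0) := by
    have : Tendsto (fun N : ℕ => (N : ℝ) + (-1)) atTop atTop :=
      tendsto_natCast_atTop_atTop.atTop_add tendsto_const_nhds
    exact this.inv_tendsto_atTop
  have h3 : Tendsto (fun N : ℕ => κ * ((N : ℝ) / ((N : ℝ) + (-1))) + C' * ((N : ℝ) + (-1))⁻¹) atTop
      (𝓝 (κ * 1 + C' * 0)) := (h1.const_mul κ).add (h2.const_mul C')
  simp only [mul_one, mul_zero, add_zero] at h3
  refine h3.congr' ?_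
  filter_upwards [eventually_gt_atTop 1] with N hN
  have hNR : (1 : ℝ) < N := by exact_mod_cast hN
  have : (N : ℝ) + (-1) ≠ 0 := by linarith
  have e : (N : ℝ) - 1 = (N : ℝ) + (-1) := by ring
  rw [e]
  field_simp

/-- **Two sign laws close the crux.** If the resistance side gives `(N−1)/D_N ≤ N/κ + C` (QSR, via
`series_abel_lower`) and the conductance side gives `(N−1)D_N ≤ Nκ + C'` (QS, via `fekete_abel_upper`, after
dividing by `T²`), then `D_N → κ`: the canonical response sequence converges to the Abel witness value — the
conclusion of `AbelThermodynamicLimit` for the given witness, with NO late-window residual. -/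
theorem two_sign_laws_tendsto (D : ℕ → ℝ) (κ C C' : ℝ) (hκ : 0 < κ) (hC : 0 ≤ C)
    (hpos : ∀ N : ℕ, 2 ≤ N → 0 < D N)
    (hlow : ∀ N : ℕ, 2 ≤ N → ((N : ℝ) - 1) / D N ≤ N * κ⁻¹ + C)
    (hup : ∀ N : ℕ, 2 ≤ N → ((N : ℝ) - 1) * D N ≤ N * κ + C') :
    Tendsto D atTop (𝓝 κ) := by
  have hlo := conductance_lower_of_resistance D κ C hκ hC hpos hlow
  refine tendsto_of_tendsto_of_tendsto_of_le_of_le' (tendsto_lower_envelope κ C)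
    (tendsto_upper_envelope κ C') ?_ ?_
  · filter_upwards [eventually_ge_atTop 2] with N hN using hlo N hN
  · filter_upwards [eventually_ge_atTop 2] with N hN
    have hNR : (2 : ℝ) ≤ N := by exact_mod_cast hN
    have hpos' : (0 : ℝ) < (N : ℝ) - 1 := by linarith
    rw [le_div_iff₀ hpos', mul_comm]
    exact hup N hN

/-- Shape of the chain-level LOWER-HALF deliverable of the card, over tree objects only: under QSR, the
fixed-ν identification and the KDN identity, for every Abel witness value `κ` of the closed chain the
canonical responses satisfy `liminf_N D_N ≥ κ` (typed as the eventual lower envelope). -/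
def LowerHalf : Prop :=
  ∀ ω₂ lam β γ : ℝ, 0 < ω₂ → 0 < lam → 0 < β → 0 < γ → ∀ T : ℝ, 0 < T →
    ∀ (D : ℕ → ℝ) (K : ℝ → ℝ) (κ ν₀ : ℝ), 0 < ν₀ → 0 < κ →
      (∀ N : ℕ, 2 ≤ N → 0 < D N ∧ Tendsto (currentResolventForm (pinnedChain ω₂ lam β γ) N T)
          (𝓝[>] 0) (𝓝 ((N - 1) * T ^ 2 * D N))) →
      (∀ ν ∈ Ioc (0 : ℝ) ν₀, Tendsto
          (fun N : ℕ => currentResolventForm (pinnedChain ω₂ lam β γ) N T ν / N) atTop (𝓝 (K ν))) →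
      Tendsto K (𝓝[>] 0) (𝓝 (T ^ 2 * κ)) →
      ∃ C : ℝ, 0 ≤ C ∧ ∀ N : ℕ, 2 ≤ N → κ * (((N : ℝ) - 1) / ((N : ℝ) + C * κ)) ≤ D N

end Summit.AtomisticToContinuum.FouriersLaw.Cruxes.AbelThermodynamicLimit.SeriesLawAtEveryLaplaceFrequency

/-! ## Card `abel-late-antiecho` -/

namespace Summit.AtomisticToContinuum.FouriersLaw.Cruxes.AbelThermodynamicLimit.AbelLateAntiecho

open Literature.MathematicalPhysics.KineticTheory.HeatConduction
open SeriesLawAtEveryLaplaceFrequency (currentAutocorr currentResolventForm)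

/-- **One-sided Abel comparison** (first lemma of card `abel-late-antiecho`; pure real analysis, PROVED):
for an integrable `c` on `(0,∞)` and `ν ≥ 0`,
`∫₀^∞ c − ∫₀^∞ e^{−νt} c = ∫₀^∞ (1 − e^{−νt}) c ≥ −∫₀^∞ (1 − e^{−νt}) c⁻`, `c⁻ = max(−c, 0)`:
the DC value of a current resolvent form sits below its value at Laplace frequency `ν` by at most the
Abel-late NEGATIVE mass of the autocorrelation — cancellations with positive late mass are not needed. -/
theorem antiecho_lower (c : ℝ → ℝ) (ν : ℝ) (hν : 0 ≤ ν)
    (h1 : IntegrableOn c (Ioi 0)) (h2 : IntegrableOn (fun t => Real.exp (-(ν * t)) * c t) (Ioi 0))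
    (h3 : IntegrableOn (fun t => (1 - Real.exp (-(ν * t))) * max (-c t) 0) (Ioi 0)) :
    -(∫ t in Ioi (0 : ℝ), (1 - Real.exp (-(ν * t))) * max (-c t) 0) ≤
      (∫ t in Ioi (0 : ℝ), c t) - ∫ t in Ioi (0 : ℝ), Real.exp (-(ν * t)) * c t := by
  rw [← integral_sub h1 h2, ← integral_neg]
  refine setIntegral_mono_on h3.neg (h1.sub h2) measurableSet_Ioi ?_
  intro t ht
  have ht' : 0 < t := ht
  have hexp : Real.exp (-(ν * t)) ≤ 1 := by
    rw [Real.exp_le_one_iff]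
    nlinarith
  have hw : 0 ≤ 1 - Real.exp (-(ν * t)) := by linarith
  have hc : -max (-c t) 0 ≤ c t := by
    have := le_max_left (-c t) 0
    linarith
  have e : c t - Real.exp (-(ν * t)) * c t = (1 - Real.exp (-(ν * t))) * c t := by ring
  rw [e, ← mul_neg]
  exact mul_le_mul_of_nonneg_left hc hw

/-- The Abel-late negative mass per chain: `a_N(ν) := ∫₀^∞ (1 − e^{−νt}) c_N⁻(t) dt`. -/
def abelLateNegativeMass (P : OscillatorChain) (N : ℕ) (T ν : ℝ) : ℝ :=
  ∫ t in Ioi (0 : ℝ), (1 - Real.exp (-(ν * t))) * max (-currentAutocorr P N T t) 0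

/-- **NoExtensiveAntiecho** (the one-sided late-window statement of card `abel-late-antiecho`): the
Abel-late NEGATIVE mass of the open chain's total-current autocorrelation is sub-extensive,
`lim_{ν↓0} limsup_N (N−1)⁻¹ ∫₀^∞ (1 − e^{−νt}) c_N⁻(t) dt = 0`, typed with the (R)-ordered quantifiers
(`∀ ε ∃ ν₀ ∀ ν ≤ ν₀ ∃ N₀ ∀ N ≥ N₀`). One-sided refinement of StaticAbelianSqueeze's UniformAbelianRegularity
(which bounds `|∫(1−e^{−νt})c_N|`): extensive POSITIVE late mass (ballistic plateaux) is allowed. -/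
def NoExtensiveAntiecho : Prop :=
  ∀ ω₂ lam β γ : ℝ, 0 < ω₂ → 0 < lam → 0 < β → 0 < γ → ∀ T : ℝ, 0 < T →
    ∀ ε : ℝ, 0 < ε → ∃ ν₀ : ℝ, 0 < ν₀ ∧ ∀ ν ∈ Ioc (0 : ℝ) ν₀, ∃ N₀ : ℕ, ∀ N : ℕ, N₀ ≤ N →
      abelLateNegativeMass (pinnedChain ω₂ lam β γ) N T ν ≤ ε * ((N : ℝ) - 1)

/-- **The lower half from the one-sided comparison** (abstract interchange lemma, real analysis):
if `F N ν − a N ν ≤ F0 N` (from `antiecho_lower` with `a` the Abel-late negative mass), if `F N ν / N → K ν`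
at each `ν ∈ (0, ν₀]` (fixed-ν identification), if the per-length negative mass is eventually below
`A ν + δ` for every `δ > 0` with `A ν → 0` as `ν ↓ 0` (NoExtensiveAntiecho), and `K ν → L` (the Abel
witness, `L = T²κ_A`), then `liminf_N F0 N / N ≥ L`, i.e. `liminf D_N ≥ κ_A`. -/
theorem antiecho_abel_lower (F a : ℕ → ℝ → ℝ) (F0 : ℕ → ℝ) (K A : ℝ → ℝ) (L ν₀ : ℝ) (hν₀ : 0 < ν₀)
    (hineq : ∀ ν ∈ Ioc (0 : ℝ) ν₀, ∀ N : ℕ, 2 ≤ N → F N ν - a N ν ≤ F0 N)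
    (hlim : ∀ ν ∈ Ioc (0 : ℝ) ν₀, Tendsto (fun N : ℕ => F N ν / N) atTop (𝓝 (K ν)))
    (ha : ∀ ν ∈ Ioc (0 : ℝ) ν₀, ∀ δ : ℝ, 0 < δ → ∀ᶠ N : ℕ in atTop, a N ν / N ≤ A ν + δ)
    (hA : Tendsto A (𝓝[>] 0) (𝓝 0)) (hK : Tendsto K (𝓝[>] 0) (𝓝 L)) :
    ∀ ε : ℝ, 0 < ε → ∀ᶠ N : ℕ in atTop, L - ε ≤ F0 N / N := by
  intro ε hε
  have hε4 : 0 < ε / 4 := by linarith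
  -- choose one admissible Laplace frequency with K ν close to L and A ν small
  have hKev : ∀ᶠ ν in 𝓝[>] (0 : ℝ), dist (K ν) L < ε / 4 := (Metric.tendsto_nhds.1 hK) _ hε4
  have hAev : ∀ᶠ ν in 𝓝[>] (0 : ℝ), dist (A ν) 0 < ε / 4 := (Metric.tendsto_nhds.1 hA) _ hε4
  obtain ⟨ν, hνK, hνA, hνmem⟩ := (hKev.and (hAev.and (Ioc_mem_nhdsGT hν₀))).exists
  rw [Real.dist_eq] at hνK hνA
  have hK' : L - ε / 4 ≤ K ν := by
    have := abs_lt.1 hνK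
    linarith [this.1]
  have hA' : A ν ≤ ε / 4 := by
    have := abs_lt.1 hνA
    simp only [sub_zero] at this
    linarith [this.2]
  have hFev : ∀ᶠ N : ℕ in atTop, dist (F N ν / N) (K ν) < ε / 4 :=
    (Metric.tendsto_nhds.1 (hlim ν hνmem)) _ hε4
  filter_upwards [hFev, ha ν hνmem (ε / 4) hε4, eventually_ge_atTop 2] with N hF haN hN
  have hNR : (2 : ℝ) ≤ N := by exact_mod_cast hN
  have hNpos : (0 : ℝ) < N := by linarith
  rw [Real.dist_eq] at hF
  have hF' : K ν - ε / 4 ≤ F N ν / N := by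
    have := abs_lt.1 hF
    linarith [this.1]
  have h1 : (F N ν - a N ν) / N ≤ F0 N / N :=
    div_le_div_of_nonneg_right (hineq ν hνmem N hN) hNpos.le
  rw [sub_div] at h1
  linarith

end Summit.AtomisticToContinuum.FouriersLaw.Cruxes.AbelThermodynamicLimit.AbelLateAntiecho
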